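import Literature.Probability.RandomPlanarGeometry.OneSidedExcursionCloudInterior
import HarnessLib

/-!
# `P_α{i ∈ int K} > 0` for every `α > 5/8`, from one-sided restriction and any `P_1`

Proof-only companion (no definition, no named fact) of `RestrictionMeasuresFiveEighths` for the
named fact
`Literature.Probability.RandomPlanarGeometry.IsRestrictionMeasure.ae_interior_nonempty_of_gt_five_eighths`
("for `α > 5/8`, `P_α`-almost every `K` has nonempty interior"), after

* G. F. Lawler, O. Schramm, W. Werner, *Conformal restriction: the chordal case*, J. Amer. Math.
  Soc. **16** (2003) 917–955, arXiv:math/0209343 (**[LSW]**), p. 4 ("when `α` is greater than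
  `5/8`, it [the restriction measure `P_α`] is not supported on simple paths", made precise on
  p. 29 after Thm. 7.3: `P_α`, `α > 5/8`, is SLE_κ plus Brownian bubbles), §8.1 (p. 31:
  `P⁺_α = F^{ℝ₊}_ℍ(P_α)`), §8.2 (the sentence preceding Prop. 8.2: "Taking unions of independent
  hulls which satisfy the right-sided restriction property, yields a realization of another
  right-sided restriction measure (and the exponent add up)") and the proof of Cor. 8.6 (p. 38:
  "the `P_α` probability that `i` ends up to the 'right' of `K` is at most `1/2`");
* G. F. Lawler, *Conformally Invariant Processes in the Plane* (2005), §9.2 Prop. 9.13 and the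
  proof of Cor. 9.11 (the hung excursion cloud realizing `P⁺_β` and charging `i`).

In [LSW] the interior points of `P_α`, `α > 5/8`, come from the Brownian bubbles of Thm. 7.3; in
the tree this is the reduction `IsRestrictionMeasure.ae_interior_nonempty_of_gt_five_eighths_of_three_leaves`
(`SLEBubblesVersionHolds`) to a Brownian bubble measure WITH INTERIOR POINTS, `Ξ(κ) ∈ Ω` a.s.
and Thm. 6.5. This file proves the POSITIVE-PROBABILITY form of the fact by a different,
one-sided argument that needs no bubbles at all — only the existence of some two-sided
restriction measure of exponent `1` (for the hung cloud of `OneSidedExcursionCloudInterior`):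
for `P = P_α`, `α = 5/8 + β`, `β > 0`, with `Q = F^{ℝ₊}_ℍ(P) = P⁺_α = F(Q₁ ⊗ Q₂)`,
`Q₁ = F^{ℝ₊}_ℍ(P_{5/8})`, `Q₂ = P⁺_β` (§8.1–8.2 with uniqueness; all theorems of the tree),

1. `K = Fill₋(K) ∩ σ(Fill₋(σK))` sidewise: a point of `ℍ` off the interior of `K` is a limit of
   points strictly to the right of `K` or of points strictly to its left
   (`RestrictionConfig.mem_closure_rightDomain_or_leftDomain_of_I_notMem_interior`, from
   `RestrictionConfig.mem_rightDomain_or_mem_leftDomain`), and the two events are mirror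
   images, so by the `σ`-invariance of `P_α` ([LSW] Rem. 3.7)
   `P{i ∉ int K} ≤ 2 · P{i ∈ cl(right domain)} = 2 · Q{i ∉ int K'}`
   (`IsRestrictionMeasure.measure_I_notMem_interior_le_two_mul`);
2. `int F(K₁' ∪ K₂') ⊇ int K₁' ∪ int K₂'`, so `Q{i ∉ int K'} ≤ Q₁{i ∉ int K'} · Q₂{i ∉ int K'}`
   (`IsRightRestrictionMeasure.measure_I_notMem_interior_le_mul`);
3. `Q₁{i ∉ int K'} = P_{5/8}{i ∈ cl(right domain)} ≤ P_{5/8}(i ∈ K) + P_{5/8}(i right of K) ≤ 0 + 1/2`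
   (the SLE_{8/3} curve misses `i`; the symmetry bound of p. 38);
4. hence **`P_α{i ∉ int K} ≤ P⁺_β{i ∉ int K'}`** (`IsRestrictionMeasure.measure_I_notMem_interior_le`)
   and, the hung cloud making `i` interior with positive probability for every `β > 0`
   (`ExcursionCloud.exists_isRightRestrictionMeasure_intPos_of_exists_one`),
   **`P_α{i ∈ int K} > 0` for every `P_α`, `α > 5/8`, given any `P_1`**
   (`IsRestrictionMeasure.measure_I_mem_interior_ne_zero_of_gt_five_eighths`), in particular
   from the three existence-only §7 leaves (`…_of_three_leaves'`).

What separates this from the named fact is a zero–one law for `P_α` (the event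
`{int K = ∅}` is dilation invariant); that upgrade is not attempted here. No new named fact.

Mathlib: `MeasureTheory.prob_compl_eq_one_iff`, `MeasureTheory.measure_union_le`,
`ENNReal.mul_inv_cancel`. Tree: `RestrictionConfig.leftFillConfig_preimage_setOf_I_notMem_interior`,
`RestrictionConfig.I_mem_of_leftFill`, `RestrictionConfig.measurableSet_setOf_I_mem_closure_rightDomain`,
`RestrictionConfig.rightDomain_reflect`, `IsRestrictionMeasure.measure_preimage_reflect`,
`IsRestrictionMeasure.map_leftFillConfig`, `IsRightRestrictionMeasure.fillUnion`, `.unique`,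
`IsRestrictionMeasure.measure_setOf_I_mem_eq_zero_of_five_eighths`,
`IsRestrictionMeasure.measure_rightOf_I_le_half`, `exists_isRestrictionMeasure_five_eighths`,
`RestrictionConfig.measurableSet_ball_subset`.

## References

* [LSW] p. 4, Thm. 7.3 (p. 29), §8.1 (p. 31), §8.2 (Prop. 8.2), proof of Cor. 8.6 (p. 38),
  Remark 3.7 (p. 14). [LawlerSchrammWerner2003Restriction]
* G. F. Lawler, *Conformally Invariant Processes in the Plane*, AMS (2005), §9.2 Prop. 9.13,
  Cor. 9.11. [Lawler2005]
-/

noncomputable section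

open Set Filter Topology Complex MeasureTheory Metric
open UpperHalfPlane (upperHalfPlaneSet isOpen_upperHalfPlaneSet)
open scoped ComplexConjugate ENNReal

namespace Literature.Probability.RandomPlanarGeometry

namespace RestrictionConfig

/-! ### Events on `Ω`: `i ∈ int K`; off the interior, `i` is a limit of one of the two sides -/

/-- **The event "`i` is an interior point of `K`" is measurable on `Ω`**: `i ∈ int K` iff some
disc `B(i, 1/(n+1))` lies in `K` (`measurableSet_ball_subset`). [folklore] -/
theorem measurableSet_setOf_I_mem_interior :
    MeasurableSet {K : RestrictionConfig | Complex.I ∈ interior (K : Set ℂ)} := by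
  have key : {K : RestrictionConfig | Complex.I ∈ interior (K : Set ℂ)} =
      ⋃ n : ℕ, {K : RestrictionConfig | ball Complex.I (1 / ((n : ℝ) + 1)) ⊆ (K : Set ℂ)} := by
    ext K
    simp only [mem_setOf_eq, mem_iUnion]
    constructor
    · intro h
      rw [mem_interior_iff_mem_nhds, Metric.mem_nhds_iff] at h
      obtain ⟨ε, hε, hball⟩ := h
      obtain ⟨n, hn⟩ := exists_nat_one_div_lt hε
      exact ⟨n, (ball_subset_ball hn.le).trans hball⟩
    · rintro ⟨n, hn⟩
      exact mem_interior.2 ⟨_, hn, isOpen_ball, mem_ball_self (by positivity)⟩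
  rw [key]
  exact MeasurableSet.iUnion fun n ↦ measurableSet_ball_subset _ _

/-- **Off the interior of `K`, the point `i` is a limit of points strictly to the right of `K`
or of points strictly to its left**: otherwise a half-disc about `i` misses both side domains,
hence lies in `K` (`mem_rightDomain_or_mem_leftDomain`: a point of `ℍ` off `K` is on one of
the two sides). [folklore] -/
theorem mem_closure_rightDomain_or_leftDomain_of_I_notMem_interior (K : RestrictionConfig)
    (h : Complex.I ∉ interior (K : Set ℂ)) :
    Complex.I ∈ closure K.rightDomain ∨ Complex.I ∈ closure K.leftDomain := by
  by_contra hcon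
  rw [not_or] at hcon
  obtain ⟨hR, hL⟩ := hcon
  apply h
  have hN : IsOpen ((upperHalfPlaneSet ∩ (closure K.rightDomain)ᶜ) ∩ (closure K.leftDomain)ᶜ) :=
    (isOpen_upperHalfPlaneSet.inter isClosed_closure.isOpen_compl).inter isClosed_closure.isOpen_compl
  have hIH : (Complex.I : ℂ) ∈ upperHalfPlaneSet := by simp [upperHalfPlaneSet]
  refine mem_interior.2 ⟨_, ?_, hN, ⟨⟨hIH, hR⟩, hL⟩⟩
  rintro z ⟨⟨hzH, hzR⟩, hzL⟩
  by_contra hzK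
  rcases K.mem_rightDomain_or_mem_leftDomain (show 0 < z.im from hzH) hzK with hz | hz
  · exact hzR (subset_closure hz)
  · exact hzL (subset_closure hz)

/-- **`σ⁻¹{i ∈ cl(right domain)} = {i ∈ cl(left domain)}`** (`rightDomain (σK) = σ(leftDomain K)`,
`σ` a homeomorphism fixing `i`). [folklore] -/
theorem reflect_preimage_setOf_I_mem_closure_rightDomain :
    reflect ⁻¹' {K : RestrictionConfig | Complex.I ∈ closure K.rightDomain} =
      {K : RestrictionConfig | Complex.I ∈ closure K.leftDomain} := by
  ext K
  simp only [mem_preimage, mem_setOf_eq, rightDomain_reflect, ← imagAxisRefl.image_closure]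
  have hI : imagAxisRefl Complex.I = Complex.I := by simp
  constructor
  · rintro ⟨w, hw, hwI⟩
    have hw' : w = Complex.I := by
      rw [← imagAxisRefl_imagAxisRefl w, hwI, hI]
    rwa [← hw']
  · exact fun h ↦ ⟨Complex.I, h, hI⟩

/-- Hence `{i ∉ int K} ⊆ E ∪ σ⁻¹E` with `E = {i ∈ cl(right domain of K)}`. [folklore] -/
theorem setOf_I_notMem_interior_subset :
    {K : RestrictionConfig | Complex.I ∉ interior (K : Set ℂ)} ⊆
      {K : RestrictionConfig | Complex.I ∈ closure K.rightDomain} ∪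
        reflect ⁻¹' {K : RestrictionConfig | Complex.I ∈ closure K.rightDomain} := by
  intro K hK
  rw [reflect_preimage_setOf_I_mem_closure_rightDomain]
  exact K.mem_closure_rightDomain_or_leftDomain_of_I_notMem_interior hK

/-- `E ⊆ {i ∈ K} ∪ rightOf i`: if `i ∈ cl(right domain)` then either `i` is in the right domain,
or `i ∈ Fill₋(K)` is not interior to the filling and lies on `K` (`I_mem_of_leftFill`). [folklore] -/
theorem setOf_I_mem_closure_rightDomain_subset :
    {K : RestrictionConfig | Complex.I ∈ closure K.rightDomain} ⊆
      {K : RestrictionConfig | Complex.I ∈ (K : Set ℂ)} ∪ rightOf Complex.I := by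
  intro K hK
  by_cases hfill : Complex.I ∈ K.leftFill
  · left
    refine I_mem_of_leftFill hfill ?_
    have : K ∈ leftFillConfig ⁻¹' {K' : RightConfig | Complex.I ∉ interior (K' : Set ℂ)} := by
      rw [leftFillConfig_preimage_setOf_I_notMem_interior]
      exact hK
    exact this
  · right
    exact (K.notMem_leftFill_iff (by simp)).1 hfill

end RestrictionConfig

open RestrictionConfig

/-! ### The three inequalities -/

/-- The event `{K' ∈ Ω₊ : i ∉ int K'}` is measurable. [folklore] -/
theorem RightConfig.measurableSet_setOf_I_notMem_interior :
    MeasurableSet {K : RightConfig | Complex.I ∉ interior (K : Set ℂ)} :=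
  RightConfig.measurableSet_setOf_I_mem_interior.compl

/-- **`P_α{i ∉ int K} ≤ 2 · F^{ℝ₊}_ℍ(P_α){i ∉ int K'}`**: `{i ∉ int K} ⊆ E ∪ σ⁻¹E`
(`setOf_I_notMem_interior_subset`), `P_α(σ⁻¹E) = P_α(E)` ([LSW] Rem. 3.7,
`IsRestrictionMeasure.measure_preimage_reflect`), and `E = (F^{ℝ₊}_ℍ)⁻¹{i ∉ int K'}`
(`leftFillConfig_preimage_setOf_I_notMem_interior`).
[cite: LawlerSchrammWerner2003Restriction, Remark 3.7 (p. 14) with §8.1 (p. 31)] -/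
theorem IsRestrictionMeasure.measure_I_notMem_interior_le_two_mul {α : ℝ} {P : Measure RestrictionConfig}
    (hP : IsRestrictionMeasure α P) :
    P {K : RestrictionConfig | Complex.I ∉ interior (K : Set ℂ)} ≤
      2 * (P.map leftFillConfig) {K' : RightConfig | Complex.I ∉ interior (K' : Set ℂ)} := by
  have hE : MeasurableSet {K : RestrictionConfig | Complex.I ∈ closure K.rightDomain} :=
    measurableSet_setOf_I_mem_closure_rightDomain
  have hmap : (P.map leftFillConfig) {K' : RightConfig | Complex.I ∉ interior (K' : Set ℂ)} =
      P {K : RestrictionConfig | Complex.I ∈ closure K.rightDomain} := by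
    rw [Measure.map_apply measurable_leftFillConfig RightConfig.measurableSet_setOf_I_notMem_interior,
      leftFillConfig_preimage_setOf_I_notMem_interior]
  rw [hmap, two_mul]
  calc P {K : RestrictionConfig | Complex.I ∉ interior (K : Set ℂ)}
      ≤ P ({K : RestrictionConfig | Complex.I ∈ closure K.rightDomain} ∪
          reflect ⁻¹' {K : RestrictionConfig | Complex.I ∈ closure K.rightDomain}) :=
        measure_mono setOf_I_notMem_interior_subset
    _ ≤ P {K : RestrictionConfig | Complex.I ∈ closure K.rightDomain} +
          P (reflect ⁻¹' {K : RestrictionConfig | Complex.I ∈ closure K.rightDomain}) :=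
        measure_union_le _ _
    _ = _ := by rw [hP.measure_preimage_reflect hE]

/-- **`P⁺_{α+β}{i ∉ int K'} ≤ P⁺_α{i ∉ int K'} · P⁺_β{i ∉ int K'}`**: in the realization
`P⁺_{α+β} = F(P⁺_α ⊗ P⁺_β)` ([LSW] §8.2; `IsRightRestrictionMeasure.fillUnion` and uniqueness),
`int F(K₁ ∪ K₂) ⊇ int K₁ ∪ int K₂`. [cite: LawlerSchrammWerner2003Restriction, §8.2 (sentence preceding Prop. 8.2) with §8.1 (uniqueness of P⁺_α)] -/
theorem IsRightRestrictionMeasure.measure_I_notMem_interior_le_mul {α β : ℝ}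
    {Q₁ Q₂ Q : Measure RightConfig} (h₁ : IsRightRestrictionMeasure α Q₁)
    (h₂ : IsRightRestrictionMeasure β Q₂) (h : IsRightRestrictionMeasure (α + β) Q) :
    Q {K : RightConfig | Complex.I ∉ interior (K : Set ℂ)} ≤
      Q₁ {K : RightConfig | Complex.I ∉ interior (K : Set ℂ)} *
        Q₂ {K : RightConfig | Complex.I ∉ interior (K : Set ℂ)} := by
  haveI := h₁.1
  haveI := h₂.1
  rw [h.unique (h₁.fillUnion h₂),
    Measure.map_apply RightConfig.measurable_fillUnion RightConfig.measurableSet_setOf_I_notMem_interior]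
  calc (Q₁.prod Q₂) ((fun p : RightConfig × RightConfig ↦ RightConfig.fillUnion p.1 p.2) ⁻¹'
          {K : RightConfig | Complex.I ∉ interior (K : Set ℂ)})
      ≤ (Q₁.prod Q₂) ({K : RightConfig | Complex.I ∉ interior (K : Set ℂ)} ×ˢ
          {K : RightConfig | Complex.I ∉ interior (K : Set ℂ)}) := by
        refine measure_mono ?_
        rintro ⟨K₁, K₂⟩ hp
        exact ⟨fun hz ↦ hp (interior_mono (RightConfig.subset_fillUnion_left K₁ K₂) hz),
          fun hz ↦ hp (interior_mono (RightConfig.subset_fillUnion_right K₁ K₂) hz)⟩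
    _ = _ := Measure.prod_prod _ _

/-- **`F^{ℝ₊}_ℍ(P_{5/8}){i ∉ int K'} ≤ 1/2`**: the event pulls back to `{i ∈ cl(right domain)}`,
which is contained in `{i ∈ K} ∪ rightOf i`; the SLE_{8/3} curve misses `i`
(`measure_setOf_I_mem_eq_zero_of_five_eighths`) and `P_{5/8}(i right of K) ≤ 1/2` (p. 38).
[cite: LawlerSchrammWerner2003Restriction, proof of Cor. 8.6 (p. 38); RohdeSchramm2005, Thm 6.4] -/
theorem IsRestrictionMeasure.map_leftFillConfig_I_notMem_interior_le_half {P₅ : Measure RestrictionConfig}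
    (hP₅ : IsRestrictionMeasure (5 / 8) P₅) :
    (P₅.map leftFillConfig) {K' : RightConfig | Complex.I ∉ interior (K' : Set ℂ)} ≤ 1 / 2 := by
  rw [Measure.map_apply measurable_leftFillConfig RightConfig.measurableSet_setOf_I_notMem_interior,
    leftFillConfig_preimage_setOf_I_notMem_interior]
  calc P₅ {K : RestrictionConfig | Complex.I ∈ closure K.rightDomain}
      ≤ P₅ ({K : RestrictionConfig | Complex.I ∈ (K : Set ℂ)} ∪ rightOf Complex.I) :=
        measure_mono setOf_I_mem_closure_rightDomain_subset
    _ ≤ P₅ {K : RestrictionConfig | Complex.I ∈ (K : Set ℂ)} + P₅ (rightOf Complex.I) :=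
        measure_union_le _ _
    _ ≤ 0 + 1 / 2 :=
        add_le_add hP₅.measure_setOf_I_mem_eq_zero_of_five_eighths.le hP₅.measure_rightOf_I_le_half
    _ = 1 / 2 := zero_add _

/-! ### `P_α{i ∉ int K} ≤ P⁺_{α − 5/8}{i ∉ int K'}`, and the positivity -/

/-- **`P_α{i ∉ int K} ≤ P⁺_β{i ∉ int K'}` for `α = 5/8 + β`** and every right-sided restriction
measure of exponent `β`: `P{i ∉ int K} ≤ 2 · Q{i ∉ int K'} ≤ 2 · Q₁{·} · Q₂{·} ≤ 2 · (1/2) · Q₂{·}`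
with `Q = F^{ℝ₊}_ℍ(P) = F(Q₁ ⊗ Q₂)`, `Q₁ = F^{ℝ₊}_ℍ(P_{5/8})` (`P_{5/8}` exists, Thm. 6.1).
[cite: LawlerSchrammWerner2003Restriction, §8.1 (p. 31), §8.2 (Prop. 8.2), proof of Cor. 8.6 (p. 38)] -/
theorem IsRestrictionMeasure.measure_I_notMem_interior_le {α β : ℝ} {P : Measure RestrictionConfig}
    (hP : IsRestrictionMeasure α P) (hαβ : α = 5 / 8 + β)
    {Q₂ : Measure RightConfig} (hQ₂ : IsRightRestrictionMeasure β Q₂) :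
    P {K : RestrictionConfig | Complex.I ∉ interior (K : Set ℂ)} ≤
      Q₂ {K : RightConfig | Complex.I ∉ interior (K : Set ℂ)} := by
  obtain ⟨P₅, hP₅⟩ := exists_isRestrictionMeasure_five_eighths
  have hQ : IsRightRestrictionMeasure (5 / 8 + β) (P.map leftFillConfig) := hαβ ▸ hP.map_leftFillConfig
  have hQ₁ : IsRightRestrictionMeasure (5 / 8) (P₅.map leftFillConfig) := hP₅.map_leftFillConfig
  calc P {K : RestrictionConfig | Complex.I ∉ interior (K : Set ℂ)}
      ≤ 2 * (P.map leftFillConfig) {K' : RightConfig | Complex.I ∉ interior (K' : Set ℂ)} :=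
        hP.measure_I_notMem_interior_le_two_mul
    _ ≤ 2 * ((P₅.map leftFillConfig) {K' : RightConfig | Complex.I ∉ interior (K' : Set ℂ)} *
          Q₂ {K : RightConfig | Complex.I ∉ interior (K : Set ℂ)}) := by
        gcongr
        exact hQ₁.measure_I_notMem_interior_le_mul hQ₂ hQ
    _ ≤ 2 * ((1 / 2) * Q₂ {K : RightConfig | Complex.I ∉ interior (K : Set ℂ)}) := by
        gcongr
        exact hP₅.map_leftFillConfig_I_notMem_interior_le_half
    _ = Q₂ {K : RightConfig | Complex.I ∉ interior (K : Set ℂ)} := by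
        rw [← mul_assoc, one_div, ENNReal.mul_inv_cancel (by norm_num) (by norm_num), one_mul]

/-- **`P_α{i ∈ int K} > 0` for every two-sided restriction measure of exponent `α > 5/8`**,
given ANY two-sided restriction measure of exponent `1`: with `β = α − 5/8`, the hung cloud
realization of `P⁺_β` makes `i` interior with positive probability
(`ExcursionCloud.exists_isRightRestrictionMeasure_intPos_of_exists_one`), so
`P_α{i ∉ int K} ≤ P⁺_β{i ∉ int K'} < 1`. (In [LSW] the interior points of `P_α` come from the
Brownian bubbles of Thm. 7.3; this is the positive-probability half of "`P_α` is not supported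
on simple paths when `α > 5/8`", p. 4, by the one-sided theory of §8.)
[cite: LawlerSchrammWerner2003Restriction, p. 4 and Thm. 7.3 (p. 29); §8.1–8.2; Lawler2005, Cor. 9.11 (proof)] -/
theorem IsRestrictionMeasure.measure_I_mem_interior_ne_zero_of_gt_five_eighths {α : ℝ}
    {P : Measure RestrictionConfig} (hP : IsRestrictionMeasure α P) (hα : 5 / 8 < α)
    (h1 : ∃ P₁ : Measure RestrictionConfig, IsRestrictionMeasure 1 P₁) :
    P {K : RestrictionConfig | Complex.I ∈ interior (K : Set ℂ)} ≠ 0 := by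
  haveI := hP.isProbabilityMeasure
  have hβ : 0 < α - 5 / 8 := by linarith
  obtain ⟨Q₂, hQ₂, hne⟩ := ExcursionCloud.exists_isRightRestrictionMeasure_intPos_of_exists_one h1 hβ
  haveI := hQ₂.1
  have hle := hP.measure_I_notMem_interior_le (by ring : α = 5 / 8 + (α - 5 / 8)) hQ₂
  have hlt : Q₂ {K : RightConfig | Complex.I ∉ interior (K : Set ℂ)} < 1 := by
    rw [show {K : RightConfig | Complex.I ∉ interior (K : Set ℂ)} =
        {K : RightConfig | Complex.I ∈ interior (K : Set ℂ)}ᶜ from rfl,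
      prob_compl_eq_one_sub RightConfig.measurableSet_setOf_I_mem_interior]
    exact ENNReal.sub_lt_self ENNReal.one_ne_top one_ne_zero hne
  intro h0
  have h1' : P {K : RestrictionConfig | Complex.I ∉ interior (K : Set ℂ)} = 1 :=
    (prob_compl_eq_one_iff measurableSet_setOf_I_mem_interior).2 h0
  exact absurd (hle.trans_lt hlt) (by rw [h1']; exact lt_irrefl 1)

/-- Hence **`P_α{int K ≠ ∅} > 0`** for `α > 5/8`, given any `P_1`.
[cite: LawlerSchrammWerner2003Restriction, p. 4 and Thm. 7.3 (p. 29); §8.1–8.2] -/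
theorem IsRestrictionMeasure.measure_interior_nonempty_ne_zero_of_gt_five_eighths {α : ℝ}
    {P : Measure RestrictionConfig} (hP : IsRestrictionMeasure α P) (hα : 5 / 8 < α)
    (h1 : ∃ P₁ : Measure RestrictionConfig, IsRestrictionMeasure 1 P₁) :
    P {K : RestrictionConfig | (interior (K : Set ℂ)).Nonempty} ≠ 0 := by
  intro h0
  refine hP.measure_I_mem_interior_ne_zero_of_gt_five_eighths hα h1 (measure_mono_null ?_ h0)
  intro K hK
  exact ⟨Complex.I, hK⟩

/-- **A two-sided restriction measure of exponent `α > 5/8` is not carried by configurations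
with empty interior**, given any `P_1` (the positive-probability form of the named fact
`IsRestrictionMeasure.ae_interior_nonempty_of_gt_five_eighths`).
[cite: LawlerSchrammWerner2003Restriction, p. 4 and Thm. 7.3 (p. 29); §8.1–8.2] -/
theorem IsRestrictionMeasure.not_ae_interior_eq_empty_of_gt_five_eighths {α : ℝ}
    {P : Measure RestrictionConfig} (hP : IsRestrictionMeasure α P) (hα : 5 / 8 < α)
    (h1 : ∃ P₁ : Measure RestrictionConfig, IsRestrictionMeasure 1 P₁) :
    ¬ ∀ᵐ K : RestrictionConfig ∂P, interior (K : Set ℂ) = ∅ := by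
  intro hae
  refine hP.measure_interior_nonempty_ne_zero_of_gt_five_eighths hα h1 ?_
  rw [ae_iff] at hae
  refine measure_mono_null (fun K hK ↦ ?_) hae
  exact fun h ↦ by simp [h] at hK

/-! ### … from the three existence-only §7 leaves -/

/-- **`P_α{i ∈ int K} > 0` for every `P_α`, `α > 5/8`, from the three existence-only §7
leaves** (a Brownian bubble measure, `Ξ(κ) ∈ Ω` a.s., Theorem 6.5 — which give `P_1` as the law
of `Ξ(2)`, `exists_isRestrictionMeasure_one_of_three_leaves`).
[cite: LawlerSchrammWerner2003Restriction, Thm. 7.3 (p. 29); §8.1–8.2] -/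
theorem IsRestrictionMeasure.measure_I_mem_interior_ne_zero_of_three_leaves
    (hμex : exists_isBrownianBubbleMeasure) (hcfg : SLEBubbles.ae_mem_restrictionConfigs)
    (h65 : SLEBubbles.lintegral_poissonAvoidance_eq_rpow) {α : ℝ} {P : Measure RestrictionConfig}
    (hP : IsRestrictionMeasure α P) (hα : 5 / 8 < α) :
    P {K : RestrictionConfig | Complex.I ∈ interior (K : Set ℂ)} ≠ 0 :=
  hP.measure_I_mem_interior_ne_zero_of_gt_five_eighths hα
    (exists_isRestrictionMeasure_one_of_three_leaves hμex hcfg h65)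

/-- `P_α{int K ≠ ∅} > 0`, `α > 5/8`, from the three existence-only §7 leaves.
[cite: LawlerSchrammWerner2003Restriction, Thm. 7.3 (p. 29); §8.1–8.2] -/
theorem IsRestrictionMeasure.measure_interior_nonempty_ne_zero_of_three_leaves
    (hμex : exists_isBrownianBubbleMeasure) (hcfg : SLEBubbles.ae_mem_restrictionConfigs)
    (h65 : SLEBubbles.lintegral_poissonAvoidance_eq_rpow) {α : ℝ} {P : Measure RestrictionConfig}
    (hP : IsRestrictionMeasure α P) (hα : 5 / 8 < α) :
    P {K : RestrictionConfig | (interior (K : Set ℂ)).Nonempty} ≠ 0 :=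
  hP.measure_interior_nonempty_ne_zero_of_gt_five_eighths hα
    (exists_isRestrictionMeasure_one_of_three_leaves hμex hcfg h65)

end Literature.Probability.RandomPlanarGeometry

end
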